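import Literature.NumberTheory.Rogawski1990.UnitOrbitalIntegralInertValueTHEigen                 -- ★ B-p12 p842182: literal-free κ = +1 value
import Literature.NumberTheory.Rogawski1990.UnitOrbitalIntegralInertValueThetaZeroCorner          -- ★ F0P3b-p01: the corner idiom (`maximalIdeal_integer_eq_span`, `exists_coe_eq_flickerU` imports)
import HarnessLib

/-!
# κ = +1 VALUE, LITERAL-FREE, FRAME ELEMENTS CONSTRUCTED: `#{q ∈ U⧸K : t q = q} = phiTHn q n N` from the local datum alone
(Flicker (1998), Prop. 11 p. 87 ∕ Theorem 18 p. 97; Rogawski (1990) §4.9)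

Topic `NumberTheory/Rogawski1990`; namespace `Literature.NumberTheory.Automorphic.UnitaryGroup`.  THEOREMS ONLY; kernel lane.  Cell `pub/hodgecm-mathlib`, road
«N7-ns COUNT FROM FLICKER», line «N7nsCount», `stub_irredGValuePos` (:1189): the CORNER layer of brick (γ) (LEAD F0P3a-plan (g9) T8-131) — ★ B-p12
`natCard_fixedPoints_unitaryInt_eq_phiTHn_of_eigen` (p842182) with `c = diag(1,−1,1)`, Flicker's level family `u_m`, and B-p12's integer frame at `R := 𝒪[K]`
(`ι := 𝒪[K].subtype`, `σR := σ|_𝒪`, `d_R := σa₀ − a₀`, `ϖ_R := ϖ`) CONSTRUCTED inside, exactly as ★ F0P3b-p01 `natCard_fixedPoints_unitaryInt_corner_eq_phiZero` does for `X₁`.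
What remains for the stub's pen: the `L_w` layer (★ p04 p842055 :80–:117 pattern: `hJ hd hσO hq a₀` at `K = L_w`) ∘ the (P3) transport ∘ (β) ★ p842227 + ★ (γ)-algebra p842239.
HONEST LABEL: HC_CM is proved only modulo the printed citations (2 remaining named inputs hLiu418, h413) until rung 0 closes.

## References
* [Flicker1998UnitaryFL] Y. Z. Flicker, *Elementary proof of the fundamental lemma for a unitary group*, Canad. J. Math. 50 (1998): Prop. 6 p. 83, Prop. 11 p. 87, Thm. 18 p. 97.
* [Rogawski1990] J. D. Rogawski, *Automorphic Representations of Unitary Groups in Three Variables* (1990), §4.9 Prop. 4.9.1 (b) p. 55.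
-/

set_option autoImplicit false

open scoped MatrixGroups WithZero Valued
open Matrix

namespace Literature.NumberTheory.Automorphic

namespace UnitaryGroup

open Literature.NumberTheory.Automorphic.HermitianLattice
open Literature.NumberTheory.Rogawski1990.Flicker1998 (phiTHn)
open IsLocalRing

variable {K : Type*} [Field K] [Valued K ℤᵐ⁰] {ϖ : K} (σ : K →+* K) {J : Matrix (Fin 3) (Fin 3) K}

section Corner

variable [IsDiscreteValuationRing 𝒪[K]] [Finite (ResidueField 𝒪[K])] [IsAdicComplete (maximalIdeal 𝒪[K]) 𝒪[K]]

set_option synthInstance.maxHeartbeats 200000 in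
-- the `H`-action on `H ⧸ (K^{u_m} ∩ H)` (as in ★ (F2))
/-- **κ = +1 VALUE from the local datum alone**: for `t ∈ U(σ, Φ₃)(K)` with an eigenvector of EVEN norm valuation, type-(2) complementary factor and observable exponents
`(n, N)`: `#{q ∈ U⧸K : t q = q} = phiTHn q n N` — frame elements `c`, `u_m`, the `𝒪[K]`-bridge constructed. [cite: Flicker1998UnitaryFL, Prop. 11 p. 87; Thm. 18 p. 97]
[cite: Rogawski1990, §4.9 Prop. 4.9.1 (b) p. 55] -/
theorem natCard_fixedPoints_unitaryInt_eq_phiTHn_of_eigen_corner (hJ : J = (StdForm.antidiagonal 3).over K) (hd : LocalConjDatum σ ϖ)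
    (hσO : ∀ y : 𝒪[K], (σ.comp 𝒪[K].subtype) y ∈ 𝒪[K]) {y : K} (hy : y * σ y = -2)
    {q : ℕ} (hq : Nat.card (ResidueField 𝒪[K]) = q ^ 2) (hq1 : 1 < q)
    {a₀ : 𝒪[K]} (ha₀ : IsUnit (((σ.comp 𝒪[K].subtype).codRestrict 𝒪[K] hσO) a₀ - a₀))
    {t : ↥(unitaryGroupOfForm σ J)} {x : Fin 3 → K} {u : K} (htx : (((t : ↥(unitaryGroupOfForm σ J)) : GL (Fin 3) K) : Matrix (Fin 3) (Fin 3) K) *ᵥ x = u • x) {k : ℤ} (hx : Valued.v (B₀ σ 3 x x) = WithZero.exp (2 * k))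
    {N n : ℕ} (hN : Valued.v ((Matrix.trace (((t : ↥(unitaryGroupOfForm σ J)) : GL (Fin 3) K) : Matrix (Fin 3) (Fin 3) K) - u) ^ 2 - 4 * (Matrix.det (((t : ↥(unitaryGroupOfForm σ J)) : GL (Fin 3) K) : Matrix (Fin 3) (Fin 3) K) / u)) = Valued.v (ϖ ^ (2 * N + 1)))
    (hn : Valued.v (u ^ 2 - (Matrix.trace (((t : ↥(unitaryGroupOfForm σ J)) : GL (Fin 3) K) : Matrix (Fin 3) (Fin 3) K) - u) * u + Matrix.det (((t : ↥(unitaryGroupOfForm σ J)) : GL (Fin 3) K) : Matrix (Fin 3) (Fin 3) K) / u) = Valued.v (ϖ ^ n))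
    (hfin : {z : ↥(unitaryGroupOfForm σ J) ⧸ unitaryInt σ J | t • z = z}.Finite) :
    (Nat.card {z : ↥(unitaryGroupOfForm σ J) ⧸ unitaryInt σ J | t • z = z} : ℚ) = phiTHn q n N := by
  classical
  have hϖ0 : ϖ ≠ 0 := hd.ϖ_ne_zero
  -- `c = diag(1, −1, 1)`
  obtain ⟨c, hc⟩ := exists_coe_eq_block_of_rel σ hJ (α := 1) (β := 0) (γ := 0) (δ := 1) (e := -1)
    (by rw [map_one, map_zero]; ring) (by rw [map_one, map_zero]; ring) (by rw [map_zero, map_one]; ring) (by rw [map_zero, map_one]; ring)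
    (by rw [map_neg, map_one]; ring)
  -- the level elements `η_m`
  have hu := fun m => exists_coe_eq_flickerU σ hJ hd hy m
  choose um hum using hu
  -- B-p12's integer frame at `R := 𝒪[K]`
  set σO : 𝒪[K] →+* 𝒪[K] := (σ.comp 𝒪[K].subtype).codRestrict 𝒪[K] hσO with hσOdef
  have hσOσO : ∀ z, σO (σO z) = z := fun z => Subtype.ext (hd.σσ (z : K))
  have hιv : ∀ x : K, Valued.v x ≤ 1 ↔ x ∈ Set.range (𝒪[K].subtype) :=
    fun x => ⟨fun hx => ⟨⟨x, hx⟩, rfl⟩, by rintro ⟨z, rfl⟩; exact z.2⟩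
  have hσι : ∀ z : 𝒪[K], 𝒪[K].subtype (σO z) = σ (𝒪[K].subtype z) := fun z => rfl
  have hdRσ : σO (σO a₀ - a₀) = -(σO a₀ - a₀) := by rw [map_sub, hσOσO]; ring
  have h2O : IsUnit (2 : 𝒪[K]) :=
    (Valuation.Integers.isUnit_iff_valuation_eq_one (Valuation.integer.integers _)).2 (by rw [map_ofNat]; exact hd.v2)
  have hϖle : Valued.v ϖ ≤ 1 := by rw [hd.vϖ, ← WithZero.exp_zero]; exact WithZero.exp_le_exp.2 (by norm_num)
  have hp : Irreducible (⟨ϖ, hϖle⟩ : 𝒪[K]) := (IsDiscreteValuationRing.irreducible_iff_uniformizer _).2 (maximalIdeal_integer_eq_span hd.vϖ)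
  exact natCard_fixedPoints_unitaryInt_eq_phiTHn_of_eigen σ hJ hd hσO hy hc um hum 𝒪[K].subtype Subtype.val_injective hιv σO hσOσO hσι
    hdRσ ha₀ h2O hp rfl hq hq hq1 ha₀ htx hx hN hn hfin

end Corner

end UnitaryGroup

end Literature.NumberTheory.Automorphic
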